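import Literature.MathematicalPhysics.QuantumFieldTheory.VillainKernelAnalysis
import Literature.MathematicalPhysics.QuantumLattice.LatticeGaugeDLR
import HarnessLib

/-!
# Villain `U(1)` on `ℤ^d`: the finite-volume theory is a probability measure, `⟨E_p⟩_Λ = 0`, and
# the field-strength observable in the `LatticeGaugeDLR` vocabulary (proofs only)

Second proof companion of `Literature/MathematicalPhysics/QuantumFieldTheory/U1VillainMasslessPhotonD4.lean`
(Fröhlich–Spencer 1982 §2.11; the free-boundary Villain theory `zdVillainMeasure β Λ`,
`zdVillainExpect`, the field strength `villainFieldStrength β (U_p)` and the two-plaquette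
function `zdVillainFieldCorr`), building on `VillainKernelAnalysis.lean`. That file leaves
unproved that "`Z_Λ ∉ {0, ∞}` (so that `zdVillainMeasure` is a probability measure) … for `β > 0`"
and that "`⟨E_p⟩_Λ = 0` by the symmetry `θ ↦ -θ`". This file declares no definition and no named
fact; for `β > 0` it PROVES:

* the plaquette field-strength observable `U ↦ E_β(arg U_p)` is continuous, bounded, measurable
  and a cylinder function of the four edges of `p`; it is gauge invariant and a local observable
  in the sense of `LatticeGaugeDLR` (`IsZdGaugeInvariant`, `IsLocalObservable`), and
  `E_{(x;i,j)} ∘ θ_v = E_{(x-v;i,j)}` for the lattice shift `configShift v`;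
* `zdVillainDensity` is continuous, positive, and pinched between two positive constants
  (`zdVillainDensity_bounds`: the `n = 0` terms below, compactness above); hence
  `zdVillainPartitionFunction β Λ ∉ {0, ∞}` and
  `isProbabilityMeasure_zdVillainMeasure : IsProbabilityMeasure (zdVillainMeasure β Λ)`;
* `zdVillainExpect_eq_mul_integral`: `⟨F⟩_Λ = Z_Λ⁻¹ ∫ (∏ φ_β) F dg_∞`;
* the reflection symmetry: the infinite Haar product on `U(1)^{E(ℤ^d)}` is invariant under
  `U ↦ U⁻¹` (`integral_zdHaar_comp_inv`, from Mathlib's `Measure.infinitePi_map_pi` and the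
  inversion invariance of Haar measure on the abelian compact group `U(1)`), the density is even
  and `E_p` odd, so **`zdVillainExpect β Λ (E_p) = 0`** (`zdVillainExpect_villainFieldStrength`):
  truncating the two-plaquette function `zdVillainFieldCorr` changes nothing;
* `FrohlichSpencerVillainMasslessPhotonD4.not_summable_of_hasBoxLimit`: the conditional form of
  the fact (any box-limit of the two-plaquette functions is the `K` of the fact, by uniqueness of
  limits, hence not summable).

Sources: J. Fröhlich, T. Spencer, CMP 83 (1982) 411, §2.2 (2.2)–(2.3), §2.11 (the objects);
everything here is elementary measure theory on those objects. [folklore]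
-/

noncomputable section

open MeasureTheory Filter Real Set
open scoped Topology ENNReal
open Literature.Probability.LatticeModels Literature.MathematicalPhysics.QuantumLattice

namespace Literature.MathematicalPhysics.QuantumFieldTheory

variable {d : ℕ}

/-! ### The plaquette field-strength observable -/

/-- `U ↦ U_p` is continuous (finitely many evaluations, products and inverses); the `U(1)` case
of `Sweep1AreaLawProofs.continuous_plaquette`, copied privately to keep the imports light. [folklore] -/
private theorem continuous_plaquette_u1 (x : Literature.Probability.LatticeModels.Site d)
    (i j : Fin d) : Continuous fun U : ZdGaugeConfig d Circle => U.plaquette x i j := by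
  unfold ZdGaugeConfig.plaquette
  fun_prop

/-- `U_p` depends only on the four edges of `p` (the `U(1)`, `(x; i, j)`-indexed case of
`ZdGaugeConfig.dependsOn_plaquette`; private local copy). [folklore] -/
private theorem dependsOn_plaquette_u1 (x : Literature.Probability.LatticeModels.Site d)
    (i j : Fin d) :
    DependsOn (fun U : ZdGaugeConfig d Circle => U.plaquette x i j)
      (({(x, i), (x + Pi.single i 1, j), (x + Pi.single j 1, i), (x, j)} : Finset (ZdEdge d)) :
        Set (ZdEdge d)) := by
  intro U V hUV
  simp only [Finset.coe_insert, Finset.coe_singleton, Set.mem_insert_iff,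
    Set.mem_singleton_iff, forall_eq_or_imp, forall_eq] at hUV
  obtain ⟨h1, h2, h3, h4⟩ := hUV
  simp only [ZdGaugeConfig.plaquette, h1, h2, h3, h4]

/-- `U ↦ E_β(arg U_p)` is continuous on configuration space (`β > 0`). [folklore] -/
theorem continuous_villainFieldStrength_plaquette {β : ℝ} (hβ : 0 < β)
    (x : Literature.Probability.LatticeModels.Site d) (i j : Fin d) :
    Continuous fun U : ZdGaugeConfig d Circle => villainFieldStrength β (U.plaquette x i j) :=
  (continuous_villainFieldStrength hβ).comp (continuous_plaquette_u1 x i j)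

/-- `U ↦ E_β(arg U_p)` is measurable (`β > 0`). [folklore] -/
theorem measurable_villainFieldStrength_plaquette {β : ℝ} (hβ : 0 < β)
    (x : Literature.Probability.LatticeModels.Site d) (i j : Fin d) :
    Measurable fun U : ZdGaugeConfig d Circle => villainFieldStrength β (U.plaquette x i j) :=
  (continuous_villainFieldStrength_plaquette hβ x i j).measurable

/-- `U ↦ E_β(arg U_p)` is bounded (`β > 0`). [folklore] -/
theorem exists_bound_villainFieldStrength_plaquette {β : ℝ} (hβ : 0 < β)
    (x : Literature.Probability.LatticeModels.Site d) (i j : Fin d) :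
    ∃ C, ∀ U : ZdGaugeConfig d Circle, |villainFieldStrength β (U.plaquette x i j)| ≤ C := by
  obtain ⟨C, hC⟩ := exists_bound_villainFieldStrength hβ
  exact ⟨C, fun U => hC _⟩

/-- `U ↦ E_β(arg U_p)` is a cylinder function of the four edges of `p`. [folklore] -/
theorem dependsOn_villainFieldStrength_plaquette (β : ℝ)
    (x : Literature.Probability.LatticeModels.Site d) (i j : Fin d) :
    DependsOn (fun U : ZdGaugeConfig d Circle => villainFieldStrength β (U.plaquette x i j))
      (({(x, i), (x + Pi.single i 1, j), (x + Pi.single j 1, i), (x, j)} : Finset (ZdEdge d)) :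
        Set (ZdEdge d)) :=
  fun U V hUV => by simp only [dependsOn_plaquette_u1 x i j hUV]

/-- `E_p` is a local observable in the sense of `LatticeGaugeDLR`. [folklore] -/
theorem isLocalObservable_villainFieldStrength_plaquette (β : ℝ)
    (x : Literature.Probability.LatticeModels.Site d) (i j : Fin d) :
    Literature.MathematicalPhysics.QuantumLattice.IsLocalObservable
      (fun U : ZdGaugeConfig d Circle => villainFieldStrength β (U.plaquette x i j)) :=
  ⟨_, dependsOn_villainFieldStrength_plaquette β x i j⟩

/-- `E_p` is gauge invariant (`U(1)` is abelian: `(U^g)_p = g_x U_p g_x⁻¹ = U_p`). [folklore] -/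
theorem isZdGaugeInvariant_villainFieldStrength_plaquette (β : ℝ)
    (x : Literature.Probability.LatticeModels.Site d) (i j : Fin d) :
    IsZdGaugeInvariant (fun U : ZdGaugeConfig d Circle => villainFieldStrength β (U.plaquette x i j)) :=
  fun g U => by
    have h : ZdGaugeConfig.plaquette (gaugeTransformZd g U) x i j = ZdGaugeConfig.plaquette U x i j := by
      have := plaquetteHolonomyZd_gaugeTransformZd g U x i j
      simp only [plaquetteHolonomyZd] at this
      simp only [ZdGaugeConfig.plaquette]
      rw [this, mul_inv_cancel_comm]
    simp only [h]

/-- `E_{(x;i,j)} ∘ θ_v = E_{(x-v;i,j)}` for the lattice shift `configShift v U e = U (e.1 - v, e.2)`.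
[folklore] -/
theorem villainFieldStrength_plaquette_configShift (β : ℝ)
    (v x : Literature.Probability.LatticeModels.Site d) (i j : Fin d) (U : ZdGaugeConfig d Circle) :
    villainFieldStrength β (ZdGaugeConfig.plaquette (configShift v U) x i j) =
      villainFieldStrength β (U.plaquette (x - v) i j) := by
  simp only [ZdGaugeConfig.plaquette, Literature.MathematicalPhysics.QuantumLattice.configShift_apply,
    add_sub_right_comm]

/-! ### The Villain density and partition function; the theory is a probability measure -/

/-- The Villain density is continuous on configuration space (`β > 0`). [folklore] -/
theorem continuous_zdVillainDensity {β : ℝ} (hβ : 0 < β)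
    (Λ : Finset (Literature.Probability.LatticeModels.Site d)) :
    Continuous (zdVillainDensity (d := d) β Λ) := by
  unfold zdVillainDensity
  exact continuous_finsetProd _ fun p _ =>
    (continuous_villainKernel_arg hβ).comp (continuous_plaquette_u1 p.1 p.2.1 p.2.2)

/-- The Villain density is positive (`β > 0`). [folklore] -/
theorem zdVillainDensity_pos {β : ℝ} (hβ : 0 < β)
    (Λ : Finset (Literature.Probability.LatticeModels.Site d)) (U : ZdGaugeConfig d Circle) :
    0 < zdVillainDensity β Λ U :=
  Finset.prod_pos fun _ _ => villainKernel_pos hβ _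

/-- Uniform bounds on the Villain density (`β > 0`): `0 < m ≤ density ≤ M` with
`m = (e^{-βπ²/2})^{#Λ'}` (the `n = 0` terms, `θ_p² ≤ π²`) and `M` from compactness of `U(1)`. [folklore] -/
theorem zdVillainDensity_bounds {β : ℝ} (hβ : 0 < β)
    (Λ : Finset (Literature.Probability.LatticeModels.Site d)) :
    ∃ m M : ℝ, 0 < m ∧ ∀ U : ZdGaugeConfig d Circle,
      m ≤ zdVillainDensity β Λ U ∧ zdVillainDensity β Λ U ≤ M := by
  obtain ⟨C, hC⟩ := exists_bound_of_continuous_circle (continuous_villainKernel_arg hβ)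
  refine ⟨Real.exp (-(β / 2) * π ^ 2) ^ (plaquettesIn Λ).card, C ^ (plaquettesIn Λ).card,
    by positivity, fun U => ⟨?_, ?_⟩⟩
  · rw [zdVillainDensity, ← Finset.prod_const]
    refine Finset.prod_le_prod (fun p _ => (Real.exp_pos _).le) fun p _ => ?_
    refine le_trans (Real.exp_le_exp.2 ?_) (exp_le_villainKernel hβ _)
    have h1 := Complex.neg_pi_lt_arg ((U.plaquette p.1 p.2.1 p.2.2 : Circle) : ℂ)
    have h2 := Complex.arg_le_pi ((U.plaquette p.1 p.2.1 p.2.2 : Circle) : ℂ)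
    have : (Complex.arg ((U.plaquette p.1 p.2.1 p.2.2 : Circle) : ℂ)) ^ 2 ≤ π ^ 2 := by
      rw [sq_le_sq, abs_of_pos Real.pi_pos, abs_le]
      exact ⟨h1.le, h2⟩
    nlinarith
  · rw [zdVillainDensity, ← Finset.prod_const]
    exact Finset.prod_le_prod (fun p _ => (villainKernel_pos hβ _).le) fun p _ =>
      (le_abs_self _).trans (hC _)

/-- The Villain partition function is finite and non-zero (`β > 0`). [folklore] -/
theorem zdVillainPartitionFunction_ne_zero_ne_top {β : ℝ} (hβ : 0 < β)
    (Λ : Finset (Literature.Probability.LatticeModels.Site d)) :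
    zdVillainPartitionFunction (d := d) β Λ ≠ 0 ∧ zdVillainPartitionFunction (d := d) β Λ ≠ ∞ := by
  obtain ⟨m, M, hm, hmM⟩ := zdVillainDensity_bounds (d := d) hβ Λ
  haveI : IsProbabilityMeasure (zdHaar d Circle) := by unfold zdHaar; infer_instance
  have hZ : zdVillainPartitionFunction (d := d) β Λ =
      ∫⁻ U, ENNReal.ofReal (zdVillainDensity β Λ U) ∂(zdHaar d Circle) := by
    rw [zdVillainPartitionFunction, zdVillainWeight, withDensity_apply _ MeasurableSet.univ,
      Measure.restrict_univ]
  constructor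
  · rw [hZ]
    refine ne_of_gt (lt_of_lt_of_le ?_ (lintegral_mono fun U => ENNReal.ofReal_le_ofReal (hmM U).1))
    rw [lintegral_const, measure_univ, mul_one]
    exact ENNReal.ofReal_pos.2 hm
  · rw [hZ]
    refine ne_of_lt (lt_of_le_of_lt (lintegral_mono fun U => ENNReal.ofReal_le_ofReal (hmM U).2) ?_)
    rw [lintegral_const, measure_univ, mul_one]
    exact ENNReal.ofReal_lt_top

/-- **The free-boundary Villain theory is a probability measure** (`β > 0`). [folklore] -/
theorem isProbabilityMeasure_zdVillainMeasure {β : ℝ} (hβ : 0 < β)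
    (Λ : Finset (Literature.Probability.LatticeModels.Site d)) :
    IsProbabilityMeasure (zdVillainMeasure (d := d) β Λ) := by
  obtain ⟨h0, htop⟩ := zdVillainPartitionFunction_ne_zero_ne_top (d := d) hβ Λ
  refine ⟨?_⟩
  rw [zdVillainMeasure, Measure.smul_apply, smul_eq_mul]
  exact ENNReal.inv_mul_cancel h0 htop

/-- The finite-volume Villain expectation as a ratio of Haar integrals (`β > 0`):
`⟨F⟩_Λ = Z_Λ⁻¹ ∫ (∏ φ_β) F dg_∞`. [folklore] -/
theorem zdVillainExpect_eq_mul_integral {β : ℝ} (hβ : 0 < β)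
    (Λ : Finset (Literature.Probability.LatticeModels.Site d)) (F : ZdGaugeConfig d Circle → ℝ) :
    zdVillainExpect β Λ F = ((zdVillainPartitionFunction (d := d) β Λ)⁻¹).toReal *
      ∫ U, zdVillainDensity β Λ U * F U ∂(zdHaar d Circle) := by
  rw [zdVillainExpect, zdVillainMeasure, integral_smul_measure, smul_eq_mul]
  congr 1
  rw [zdVillainWeight]
  have hm : Measurable fun U => (zdVillainDensity β Λ U).toNNReal :=
    (continuous_zdVillainDensity hβ Λ).measurable.real_toNNReal
  have hfun : (fun U => ENNReal.ofReal (zdVillainDensity β Λ U)) =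
      fun U => ((zdVillainDensity β Λ U).toNNReal : ℝ≥0∞) := rfl
  rw [hfun, integral_withDensity_eq_integral_smul hm]
  refine integral_congr_ae (Eventually.of_forall fun U => ?_)
  simp only [NNReal.smul_def, smul_eq_mul, Real.coe_toNNReal _ (zdVillainDensity_pos hβ Λ U).le]

/-- The expectation of the constant `1` is `1` (`β > 0`). [folklore] -/
theorem zdVillainExpect_one {β : ℝ} (hβ : 0 < β)
    (Λ : Finset (Literature.Probability.LatticeModels.Site d)) :
    zdVillainExpect β Λ (fun _ => (1 : ℝ)) = 1 := by
  haveI := isProbabilityMeasure_zdVillainMeasure (d := d) hβ Λ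
  rw [zdVillainExpect, integral_const, smul_eq_mul, mul_one, probReal_univ]

/-! ### The reflection symmetry `U ↦ U⁻¹` and `⟨E_p⟩_Λ = 0` -/

/-- Plaquettes of the pointwise-inverted (complex-conjugated) configuration `U⁻¹ : e ↦ (U e)⁻¹`
are the inverses: `(U⁻¹)_p = (U_p)⁻¹` (`U(1)` is abelian). [folklore] -/
theorem plaquette_inv (U : ZdGaugeConfig d Circle) (x : Literature.Probability.LatticeModels.Site d)
    (i j : Fin d) :
    ZdGaugeConfig.plaquette (fun e => (U e)⁻¹) x i j = (U.plaquette x i j)⁻¹ := by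
  simp only [ZdGaugeConfig.plaquette, mul_inv, inv_inv]

/-- The Villain density is even under `U ↦ U⁻¹`. [folklore] -/
theorem zdVillainDensity_inv (β : ℝ) (Λ : Finset (Literature.Probability.LatticeModels.Site d))
    (U : ZdGaugeConfig d Circle) :
    zdVillainDensity β Λ (fun e => (U e)⁻¹) = zdVillainDensity β Λ U := by
  unfold zdVillainDensity
  refine Finset.prod_congr rfl fun p _ => ?_
  rw [plaquette_inv, villainKernel_arg_inv]

/-- The infinite Haar product on `U(1)` configurations is invariant under `U ↦ U⁻¹`
(coordinatewise inversion; Haar measure on the abelian compact group `U(1)` is inversion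
invariant), in integrated form. [folklore] -/
theorem integral_zdHaar_comp_inv (g : ZdGaugeConfig d Circle → ℝ) :
    ∫ U, g (fun e => (U e)⁻¹) ∂(zdHaar d Circle) = ∫ U, g U ∂(zdHaar d Circle) := by
  set T : ZdGaugeConfig d Circle ≃ᵐ ZdGaugeConfig d Circle :=
    MeasurableEquiv.piCongrRight fun _ => MeasurableEquiv.inv Circle with hT
  have hTapp : (⇑T) = fun (U : ZdGaugeConfig d Circle) (e : ZdEdge d) => (U e)⁻¹ := rfl
  haveI : (haarProbability Circle).IsInvInvariant := by
    unfold haarProbability; infer_instance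
  have hpres : MeasurePreserving T (zdHaar d Circle) (zdHaar d Circle) := by
    refine ⟨T.measurable, ?_⟩
    rw [hTapp, zdHaar, Measure.infinitePi_map_pi (fun _ => haarProbability Circle)
      (fun _ => measurable_inv)]
    simp only [Measure.map_inv_eq_self]
  have := hpres.integral_comp' g
  rwa [hTapp] at this

/-- **`⟨E_p⟩_Λ(β) = 0`**: the field-strength observable is odd (`villainFieldStrength_inv`) and the
Villain measure even under `U ↦ U⁻¹`, so its finite-volume expectation vanishes; in particular
the two-plaquette function `zdVillainFieldCorr` equals its truncated version (`β > 0`). [folklore] -/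
theorem zdVillainExpect_villainFieldStrength {β : ℝ} (hβ : 0 < β)
    (Λ : Finset (Literature.Probability.LatticeModels.Site d))
    (x : Literature.Probability.LatticeModels.Site d) (i j : Fin d) :
    zdVillainExpect β Λ (fun U => villainFieldStrength β (U.plaquette x i j)) = 0 := by
  rw [zdVillainExpect_eq_mul_integral hβ]
  have h := integral_zdHaar_comp_inv (d := d)
    (fun U => zdVillainDensity β Λ U * villainFieldStrength β (U.plaquette x i j))
  simp only [zdVillainDensity_inv, plaquette_inv, villainFieldStrength_inv, mul_neg,
    integral_neg] at h
  have h0 : ∫ U, zdVillainDensity β Λ U * villainFieldStrength β (U.plaquette x i j)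
      ∂(zdHaar d Circle) = 0 := by
    linarith
  rw [h0, mul_zero]

/-! ### The conditional form of the Fröhlich–Spencer fact -/

/-- **Conditional form of `FrohlichSpencerVillainMasslessPhotonD4`.** For `β > β₀`, `i < j`, ANY
function `G` that is the box limit of the finite-volume two-plaquette functions
`zdVillainFieldCorr β · i j x` for all `x` is not summable (it coincides with the `K` of the fact
by uniqueness of limits, `tendsto_nhds_unique`). [folklore] -/
theorem FrohlichSpencerVillainMasslessPhotonD4.not_summable_of_hasBoxLimit
    (h : FrohlichSpencerVillainMasslessPhotonD4) :
    ∃ β₀ : ℝ, ∀ β : ℝ, β₀ < β → ∀ i j : Fin 4, i < j →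
      ∀ G : Literature.Probability.LatticeModels.Site 4 → ℝ,
        (∀ x, HasBoxLimit (fun Λ => zdVillainFieldCorr β Λ i j x) (G x)) → ¬ Summable G := by
  obtain ⟨β₀, hβ⟩ := h
  refine ⟨β₀, fun β hb i j hij G hG hsum => ?_⟩
  obtain ⟨K, hK, hns⟩ := hβ β hb i j hij
  have hGK : G = K := funext fun x => tendsto_nhds_unique (hG x) (hK x)
  subst hGK
  exact hns hsum.abs

end Literature.MathematicalPhysics.QuantumFieldTheory
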